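/-
Copyright (c) 2026 the pub-hodgecm-mathlib formalisation cell (harness21).  Prover seat hodgecm-mathlib-LH4-p09 (g3), «(D-RAM) FOUR-FRAME» road of crux H413, line LH4,
unit U3_Laws (iii), (R-22) «κS-RECUT» — the parity leaf (a) of REF5 (g22) R5-122 (statement and proof route hers, checked there; dealt by pen LH4-plan (g12) WORD #6 (3)).  2026-09-04.
-/
import Literature.NumberTheory.Automorphic.UnitaryThreeFourFrameDefs                        -- ★ #0a (B-p04): `IsRamifiedQuadraticDatum`
import Summits.HodgeConjecture.HodgeConjecture.Theorems.F0P3cDyRamFourFrameLawDefsR          -- ★ DEFS LEAF №1-R (p855074): `even_t_of_isRamifiedQuadraticDatum`, `shiftR`, `shiftT`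
import HarnessLib

/-!
# Crux `H413`, line LH4 «(D-RAM) FOUR-FRAME» road — unit U3_Laws (iii), (R-22) «κS-RECUT»: THE DATUM PARITY LEAF `d ≤ t + 1 ∧ (d odd ↔ d = t + 1)`

Cell `hodgecm-mathlib` (D-0151), FLOOR 0, crux item H413 = `stmt-HodgeConjecture-24833`, route of record `HCCMUnconditional`; squad F0∕P3c∕LH4 (req618∕req620).
THEOREMS ONLY (no `def`, no instance, no notation, no `sorry`); lane `--supports stmt-HodgeConjecture-24833` (count-neutral).  One lemma + three `omega`∕`simp`-grade
corollaries; consumed by LH4-p10 (g3)'s OF-RECORD DISCHARGE of the Ω-bridge ★ `F0P3cDyRamKappaSignLawR2Bridge` (p857007) on the branch `d % 2 = 1` (REF5 R5-122 (2):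
there `t = d − 1`, so an axis below level `2d − 1` has `2B ≤ 1`, i.e. is NOT READ by the law) and by anyone who needs to retire the side hypothesis `d = t ∨ d = t + 1` of
★ №1-R's `…_iff_of_maximal` lemmas on the odd half.

THE MATHEMATICS (REF5 (g22) R5-122 (a), checked there: `DOddBridge.v1.lean` 72ef1d23ac97b097, TRIO).  For a ramified quadratic datum `(σ, ϖ, d, t)` — `σ` an involutive
isometry, `|ϖ| = exp(−1)`, every non-zero `σ`-fixed element of EVEN order, `|ϖ − σϖ| = |ϖ|^d`, `|2| = |ϖ|^t` — the `σ`-fixed element `s = ϖ + σϖ = (ϖ − σϖ) + 2σϖ` has the two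
summands of orders `d` and `t + 1`.  If `d < t + 1` the first dominates, `s ≠ 0` has order `d`, so `d` is even; if `d > t + 1` the second dominates and `t + 1` would be even —
but `t` is even (★ `even_t_of_isRamifiedQuadraticDatum`: `2` is fixed and non-zero), contradiction; so `d ≤ t + 1`, and `d` is odd iff `d = t + 1` (then odd since `t` is even).
In Serre's language: the different exponent `d` of a wildly ramified quadratic extension of a dyadic field satisfies `d ≤ 2e + 1 = t + 1` with equality iff `d` is odd.
HONEST LABEL.  Count-neutral (`--supports`); nothing printed is asserted; the κS laws stay PROVER TARGETS under (R-22) review; `HC_CM` is proved only modulo the 7 printed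
citations (2 remaining named inputs: hLiu418 = `stmt-HodgeConjecture-24832`, h413 = `stmt-HodgeConjecture-24833`) until rung 0 closes.

## References
* [Serre1979] J.-P. Serre, *Local Fields*, GTM 67 (1979), Ch. IV §1 Prop. 4 and Ch. IV §2 (the different and the ramification breaks of a totally ramified extension; `v(𝔇) ≤ e − 1 + v(e)`
  with the parity constraint), Ch. III §6 Prop. 13 (bound on the different).
-/

set_option autoImplicit false

namespace Summit.HodgeConjecture.HodgeConjecture.Cruxes.H413.F0P3cDyRamDatumParity

open WithZero
open Literature.NumberTheory.Automorphic Literature.NumberTheory.Automorphic.UnitaryThreeFourFrame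
open Summit.HodgeConjecture.HodgeConjecture.Cruxes.H413.F0P3cDyRamFourFrameLawDefs
open Summit.HodgeConjecture.HodgeConjecture.Cruxes.H413.F0P3cDyRamFourFrameLawDefsR
open scoped Valued WithZero

variable {K : Type} [Field K] [Valued K ℤᵐ⁰]

/-- **THE DATUM PARITY LEMMA** (REF5 (g22) R5-122 (a)): for a ramified quadratic datum, `d ≤ t + 1`, and `d` is odd iff `d = t + 1`.
[cite: Serre1979, Ch. IV §1 Prop. 4; Ch. III §6 Prop. 13] -/
theorem d_le_and_odd_iff_of_isRamifiedQuadraticDatum {σ : K →+* K} {ϖ : K} {d t : ℕ} (hD : IsRamifiedQuadraticDatum σ ϖ d t) :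
    d ≤ t + 1 ∧ (d % 2 = 1 ↔ d = t + 1) := by
  have ht : t % 2 = 0 := even_t_of_isRamifiedQuadraticDatum hD
  obtain ⟨hσ, hvσ, hϖ, hfix, hd, -, h2⟩ := hD
  -- the two summands of `s = (ϖ − σϖ) + 2σϖ = ϖ + σϖ`
  have hvϖn : ∀ n : ℕ, Valued.v ϖ ^ n = exp (-(n : ℤ)) := fun n => by
    rw [hϖ, ← exp_nsmul, nsmul_eq_mul, mul_neg, mul_one]
  have hA : Valued.v (ϖ - σ ϖ) = exp (-(d : ℤ)) := by rw [hd, hvϖn]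
  have hB : Valued.v (2 * σ ϖ) = exp (-((t + 1 : ℕ) : ℤ)) := by
    rw [map_mul, h2, hvσ, ← pow_succ, hvϖn]
  have hs : (ϖ - σ ϖ) + 2 * σ ϖ = ϖ + σ ϖ := by ring
  have hσs : σ (ϖ + σ ϖ) = ϖ + σ ϖ := by rw [map_add, hσ, add_comm]
  -- an order computation for `s` whenever one summand strictly dominates
  have hfixed : ∀ {m : ℕ}, Valued.v (ϖ + σ ϖ) = exp (-(m : ℤ)) → m % 2 = 0 := by
    intro m hm
    have hs0 : ϖ + σ ϖ ≠ 0 := fun h => by rw [h, map_zero] at hm; exact WithZero.zero_ne_coe hm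
    obtain ⟨n, hn⟩ := hfix _ hσs hs0
    rw [hm] at hn
    have := exp_injective hn
    omega
  rcases Nat.lt_trichotomy d (t + 1) with hlt | heq | hgt
  · -- `d < t + 1`: the first summand dominates, `d` is even
    have hdom : Valued.v (2 * σ ϖ) < Valued.v (ϖ - σ ϖ) := by
      rw [hA, hB, exp_lt_exp]; omega
    have hvs : Valued.v (ϖ + σ ϖ) = exp (-(d : ℤ)) := by rw [← hs, Valuation.map_add_eq_of_lt_left _ hdom, hA]
    have hd2 := hfixed hvs
    exact ⟨hlt.le, ⟨fun h => by omega, fun h => by omega⟩⟩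
  · exact ⟨heq.le, ⟨fun _ => heq, fun _ => by omega⟩⟩
  · -- `d > t + 1`: the second summand dominates, `t + 1` would be even — impossible
    have hdom : Valued.v (ϖ - σ ϖ) < Valued.v (2 * σ ϖ) := by
      rw [hA, hB, exp_lt_exp]; omega
    have hvs : Valued.v (ϖ + σ ϖ) = exp (-((t + 1 : ℕ) : ℤ)) := by rw [← hs, Valuation.map_add_eq_of_lt_right _ hdom, hB]
    have := hfixed hvs
    omega

/-- Corollary · `d` odd ⇒ `d = t + 1`. [cite: Serre1979, Ch. IV §1 Prop. 4] -/
theorem d_eq_t_add_one_of_odd {σ : K →+* K} {ϖ : K} {d t : ℕ} (hD : IsRamifiedQuadraticDatum σ ϖ d t) (hodd : d % 2 = 1) : d = t + 1 :=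
  (d_le_and_odd_iff_of_isRamifiedQuadraticDatum hD).2.1 hodd

/-- Corollary · `d ≤ t` unless `d = t + 1`; in particular `d` even ⇒ `d ≤ t`. [cite: Serre1979, Ch. IV §1 Prop. 4] -/
theorem d_le_t_of_even {σ : K →+* K} {ϖ : K} {d t : ℕ} (hD : IsRamifiedQuadraticDatum σ ϖ d t) (heven : d % 2 = 0) : d ≤ t := by
  have h := d_le_and_odd_iff_of_isRamifiedQuadraticDatum hD
  rcases h.1.lt_or_eq with hlt | heq
  · omega
  · exact absurd (h.2.2 heq) (by omega)

/-- Corollary · on the odd branch the two schedule tokens coincide: `d` odd ⇒ `shiftR d t = t = shiftT d t` (`d − d%2 = d − 1 = t`). [cite: Serre1979, Ch. IV §1 Prop. 4] -/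
theorem shiftR_eq_of_odd {σ : K →+* K} {ϖ : K} {d t : ℕ} (hD : IsRamifiedQuadraticDatum σ ϖ d t) (hodd : d % 2 = 1) :
    shiftR d t = (t : ℤ) ∧ shiftR d t = shiftT d t := by
  have h := d_eq_t_add_one_of_odd hD hodd
  refine ⟨?_, ?_⟩
  · simp only [shiftR]
    omega
  · simp only [shiftR, shiftT]
    omega

end Summit.HodgeConjecture.HodgeConjecture.Cruxes.H413.F0P3cDyRamDatumParity
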